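import Summits.NavierStokesRegularity.NavierStokesRegularity.Theorems.AsymmetricFlickerLiouville.Negative.AsTypedIsFDL
import Summits.NavierStokesRegularity.NavierStokesRegularity.Theorems.CalmSliceGateAsymmetricFlickerLiouvilleUnsteadinessPower
import Summits.NavierStokesRegularity.NavierStokesRegularity.Theorems.CalmSliceGateAsymmetricFlickerLiouvilleAsymmetryPower
import HarnessLib

/-!
# Crux `AsymmetricFlickerLiouville` (stmt-NavierStokesRegularity-24453, route `CalmSliceGate`):
# the registered line's one open stub `stub_powerLiouville`, universally closed over its parameters,
# IS `FiniteDissipationLiouville` in the kernel — the power floors are decoration for singular members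

Refuter-side negative-lane file (seat ns-afl-r1 g6, `--supports stmt-NavierStokesRegularity-24453`;
hypothesis-mutation finding, D-0016 step 5), companion of `…Negative.AsTypedIsFDL`
(`AsymmetricFlickerLiouville ⟺ FiniteDissipationLiouville ⟺ PerpetualFlickerLiouville`).
Navier–Stokes regularity is NOT proved here; no summit statement is; the stub, the crux and the
wall `FiniteDissipationLiouville` (stmt-22144) stay OPEN.

The registered skeleton of 24453 (planner ns-idea-3 g3, sha 374f0cee…, stubs
`stub_unsteadinessPower` ✓ p599371, `stub_asymmetryPower` ✓ p600539, `stub_powerLiouville` OPEN)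
reduces the crux to `stub_powerLiouville`: a member `w` of a finite-dissipation stratum `𝒟_{C,K}`
carrying, at EVERY `t < 0`, a scale-critical `L²` POWER `≥ c(−t)^{3/2}` of the unsteadiness on
`B(0, 2R√(−t))` (`hP`) and a scale-critical `L²` power `≥ c'(−t)^{3/2}` of the Killing defect about
EVERY axis on `B(0, 2R'√(−t))` (`hA`) is regular at the apex.

* `powerLiouville_iff_finiteDissipationLiouville` — **the universal closure of `stub_powerLiouville`
  (over `C K c R c' R'`, exactly as the skeleton consumes it) is EQUIVALENT to
  `FiniteDissipationLiouville`**.  `⇐` drops `hP`, `hA`.  `⇒`: a singular member of `𝒟_{C,K}` has the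
  one-point unsteadiness floor of K1 (`PerpetualFlickerLiouville.Links.flicker_of_singular`) and the
  one-point asymmetry floor about every axis (`Negative.asymmetric_of_singular`, LINE 2), which the
  two LANDED stubs `Birth.stub_unsteadinessPower` / `Birth.stub_asymmetryPower` upgrade to the power
  floors `hP`, `hA`; so for singular members both power hypotheses HOLD AUTOMATICALLY and the stub's
  content is exactly "every member of every `𝒟_{C,K}` is regular" = the wall.
* `powerLiouville_iff_asymmetricFlickerLiouville` — hence ⟺ the crux 24453 as typed.

Refuter reading (numbers, not adjectives): dropping BOTH floor hypotheses `hP`, `hA` from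
`stub_powerLiouville` changes nothing (step-5 mutation: "hP, hA unnecessary" — derivable from the
negated conclusion for members of `𝒟`); the line's open residue has the same refutation-candidate
class as 22144/24374/24453 (VERDICT-TABLES-DSS-v1: 0/9 rows resident); a proof of the stub is a
proof of `FiniteDissipationLiouville` outright.  No definitions; standard axioms.
-/

noncomputable section

-- the summit and its single sub-problem share the name (CONVENTIONS §1), as in every Theorems file
set_option linter.dupNamespace false

namespace Summit.NavierStokesRegularity.NavierStokesRegularity.Theorems.AsymmetricFlickerLiouville.Negative

open MeasureTheory Set Filter Topology Metric Function
open Literature.Analysis Literature.Analysis.FluidPDE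
open Summit.NavierStokesRegularity.NavierStokesRegularity.Theorems
open scoped ENNReal NNReal

/-- **`stub_powerLiouville` (closed over all its parameters) ⟺ `FiniteDissipationLiouville`.**
The left side is VERBATIM the registered signature of `stub_powerLiouville` with its binders
`(C K c R c' R') (hc) (hR) (hc') (hR') (w) (hw) (hD) (hP) (hA)` universally quantified. [folklore] -/
theorem powerLiouville_iff_finiteDissipationLiouville :
    (∀ (C K c R c' R' : ℝ), 0 < c → 0 < R → 0 < c' → 0 < R' →
      ∀ (w : ℝ → EuclideanSpace ℝ (Fin 3) → EuclideanSpace ℝ (Fin 3)), IsTypeIAncientMild C w →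
      (∀ s : ℝ, s < 0 → ∫⁻ x, ‖fderiv ℝ (w s) x‖ₑ ^ 2 ≤ ENNReal.ofReal (K / Real.sqrt (-s))) →
      (∀ t < 0, ENNReal.ofReal (c * (-t) ^ (3 / 2 : ℝ)) ≤
        ∫⁻ x in Metric.ball (0 : EuclideanSpace ℝ (Fin 3)) (2 * R * Real.sqrt (-t)),
          ‖Real.sqrt (-t) • ((-t) • deriv (fun τ => w τ x) t - (1 / 2 : ℝ) • w t x -
            (1 / 2 : ℝ) • fderiv ℝ (w t) x x)‖ₑ ^ 2) →
      (∀ t < 0, ∀ g : EuclideanSpace ℝ (Fin 3) ≃ₗᵢ[ℝ] EuclideanSpace ℝ (Fin 3),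
        ENNReal.ofReal (c' * (-t) ^ (3 / 2 : ℝ)) ≤
          ∫⁻ x in Metric.ball (0 : EuclideanSpace ℝ (Fin 3)) (2 * R' * Real.sqrt (-t)),
            ‖Real.sqrt (-t) • deriv (fun θ : ℝ => w t (g (rotZ θ (g.symm x))) -
              g (rotZ θ (g.symm (w t x)))) 0‖ₑ ^ 2) →
      ¬ (∀ r > 0, ∀ M : ℝ, ∃ t ∈ Set.Ioo (-(r ^ 2)) (0 : ℝ),
        ∃ x ∈ Metric.ball (0 : EuclideanSpace ℝ (Fin 3)) r, M < ‖w t x‖)) ↔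
    Theses.LerayQuarterDissipation.FiniteDissipationLiouville := by
  constructor
  · intro hPL C K w hw hD hsing
    -- one-point floors of a singular member (K1 and LINE 2), then the two landed power stubs
    obtain ⟨δ, hδ, R, hR, hflo⟩ := PerpetualFlickerLiouville.Links.flicker_of_singular C K
    obtain ⟨δ', hδ', R', hR', hasy⟩ := asymmetric_of_singular C K
    obtain ⟨c, hc, hpow⟩ := AsymmetricFlickerLiouville.Birth.stub_unsteadinessPower C δ R hδ hR
    obtain ⟨c', hc', hkil⟩ := AsymmetricFlickerLiouville.Birth.stub_asymmetryPower C δ' R' hδ' hR'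
    exact hPL C K c R c' R' hc hR hc' hR' w hw hD
      (fun t ht => hpow w hw t ht (hflo w hw hD hsing t ht))
      (fun t ht g => hkil w hw t ht g (hasy w hw hD hsing t ht g)) hsing
  · intro hFDL C K c R c' R' _ _ _ _ w hw hD _ _
    exact hFDL C K w hw hD

/-- **`stub_powerLiouville` (closed over all its parameters) ⟺ the crux `AsymmetricFlickerLiouville`
as typed** (via `finiteDissipationLiouville_iff_asymmetricFlickerLiouville`). [folklore] -/
theorem powerLiouville_iff_asymmetricFlickerLiouville :
    (∀ (C K c R c' R' : ℝ), 0 < c → 0 < R → 0 < c' → 0 < R' →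
      ∀ (w : ℝ → EuclideanSpace ℝ (Fin 3) → EuclideanSpace ℝ (Fin 3)), IsTypeIAncientMild C w →
      (∀ s : ℝ, s < 0 → ∫⁻ x, ‖fderiv ℝ (w s) x‖ₑ ^ 2 ≤ ENNReal.ofReal (K / Real.sqrt (-s))) →
      (∀ t < 0, ENNReal.ofReal (c * (-t) ^ (3 / 2 : ℝ)) ≤
        ∫⁻ x in Metric.ball (0 : EuclideanSpace ℝ (Fin 3)) (2 * R * Real.sqrt (-t)),
          ‖Real.sqrt (-t) • ((-t) • deriv (fun τ => w τ x) t - (1 / 2 : ℝ) • w t x -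
            (1 / 2 : ℝ) • fderiv ℝ (w t) x x)‖ₑ ^ 2) →
      (∀ t < 0, ∀ g : EuclideanSpace ℝ (Fin 3) ≃ₗᵢ[ℝ] EuclideanSpace ℝ (Fin 3),
        ENNReal.ofReal (c' * (-t) ^ (3 / 2 : ℝ)) ≤
          ∫⁻ x in Metric.ball (0 : EuclideanSpace ℝ (Fin 3)) (2 * R' * Real.sqrt (-t)),
            ‖Real.sqrt (-t) • deriv (fun θ : ℝ => w t (g (rotZ θ (g.symm x))) -
              g (rotZ θ (g.symm (w t x)))) 0‖ₑ ^ 2) →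
      ¬ (∀ r > 0, ∀ M : ℝ, ∃ t ∈ Set.Ioo (-(r ^ 2)) (0 : ℝ),
        ∃ x ∈ Metric.ball (0 : EuclideanSpace ℝ (Fin 3)) r, M < ‖w t x‖)) ↔
    Theses.CalmSliceGate.AsymmetricFlickerLiouville :=
  powerLiouville_iff_finiteDissipationLiouville.trans
    finiteDissipationLiouville_iff_asymmetricFlickerLiouville

/-- **The power floors are automatic for singular members**: every singular member of a stratum
`𝒟_{C,K}` satisfies BOTH power hypotheses of `stub_powerLiouville`, with class constants
`c(C,K), R(C,K), c'(C,K), R'(C,K)` (K1 + LINE 2 + the two landed stubs). [folklore] -/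
theorem powerFloors_of_singular (C K : ℝ) :
    ∃ c > 0, ∃ R > 0, ∃ c' > 0, ∃ R' > 0,
      ∀ (w : ℝ → EuclideanSpace ℝ (Fin 3) → EuclideanSpace ℝ (Fin 3)), IsTypeIAncientMild C w →
      (∀ s : ℝ, s < 0 → ∫⁻ x, ‖fderiv ℝ (w s) x‖ₑ ^ 2 ≤ ENNReal.ofReal (K / Real.sqrt (-s))) →
      (∀ r > 0, ∀ M : ℝ, ∃ t ∈ Set.Ioo (-(r ^ 2)) (0 : ℝ),
        ∃ x ∈ Metric.ball (0 : EuclideanSpace ℝ (Fin 3)) r, M < ‖w t x‖) →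
      (∀ t < 0, ENNReal.ofReal (c * (-t) ^ (3 / 2 : ℝ)) ≤
        ∫⁻ x in Metric.ball (0 : EuclideanSpace ℝ (Fin 3)) (2 * R * Real.sqrt (-t)),
          ‖Real.sqrt (-t) • ((-t) • deriv (fun τ => w τ x) t - (1 / 2 : ℝ) • w t x -
            (1 / 2 : ℝ) • fderiv ℝ (w t) x x)‖ₑ ^ 2) ∧
      (∀ t < 0, ∀ g : EuclideanSpace ℝ (Fin 3) ≃ₗᵢ[ℝ] EuclideanSpace ℝ (Fin 3),
        ENNReal.ofReal (c' * (-t) ^ (3 / 2 : ℝ)) ≤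
          ∫⁻ x in Metric.ball (0 : EuclideanSpace ℝ (Fin 3)) (2 * R' * Real.sqrt (-t)),
            ‖Real.sqrt (-t) • deriv (fun θ : ℝ => w t (g (rotZ θ (g.symm x))) -
              g (rotZ θ (g.symm (w t x)))) 0‖ₑ ^ 2) := by
  obtain ⟨δ, hδ, R, hR, hflo⟩ := PerpetualFlickerLiouville.Links.flicker_of_singular C K
  obtain ⟨δ', hδ', R', hR', hasy⟩ := asymmetric_of_singular C K
  obtain ⟨c, hc, hpow⟩ := AsymmetricFlickerLiouville.Birth.stub_unsteadinessPower C δ R hδ hR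
  obtain ⟨c', hc', hkil⟩ := AsymmetricFlickerLiouville.Birth.stub_asymmetryPower C δ' R' hδ' hR'
  exact ⟨c, hc, R, hR, c', hc', R', hR', fun w hw hD hsing =>
    ⟨fun t ht => hpow w hw t ht (hflo w hw hD hsing t ht),
      fun t ht g => hkil w hw t ht g (hasy w hw hD hsing t ht g)⟩⟩

end Summit.NavierStokesRegularity.NavierStokesRegularity.Theorems.AsymmetricFlickerLiouville.Negative

end
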